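import Summits.PneNP.GCT.Max.DetKYLeadingTermsTwo
import Mathlib.Combinatorics.Enumerative.InclusionExclusion
import HarnessLib
import HarnessLib.Audit

/-!
# `GCT/Max`: the inclusion–exclusion EVALUATION of the leading-label count `LT2_σ(n,p,k)` (W2a′ of theory-2's memo
# `FINDINGS-LT2.md`, Thm 2; cell `pub-gct-max`, track F)

`Summits/PneNP/GCT/Max/DetKYLeadingTermsTwo.lean` proves `lt2Count n p k σ ≤ rank KY_{p,k}(det_n)` with `lt2Count` DEFINED as the number of
`σ`-achievable labels `(T, I′, J′)`. Evaluating that definition is hopeless beyond toy sizes (`C(n², p+1)·C(n, k+1)²` labels). This module proves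
the closed evaluation used by the cell's calculations (memo Thm 2):

  `LT2_σ(n,p,k) = Σ_{I′,J′} Σ_{∅ ≠ C ⊆ I′×J′} (−1)^{|C|+1} · C(a_C, n² − 1 − p)`,

where `a_C = |allowed(C)|` counts the positions `q` that may lie in the complement `U = T^c` simultaneously for every witness `w ∈ C`:
`q ≠ w` and (`σ q < σ w` or `q` in the block of `w`). Proof: fibrewise over `(I′, J′)`; the achievable `T` form the union over the
witnesses `w ∈ I′×J′` of `A_w = {T : |T| = p+1, achievable by w}` (Mathlib's `Finset.inclusion_exclusion_card_biUnion`); and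
`⋂_{w∈C} A_w ≃ {U ⊆ allowed(C) : |U| = n² − 1 − p}` by complementation (`Finset.card_powersetCard`). Kernel sanity: `lt2IE 3 4 1 1 = 726`.
PACKAGED (PROVED): `LT2InclusionExclusion` (`lt2Count = lt2IE` for `p+1 ≤ n²`) and the certificate interface `LT2Certificate`
(`b ≤ lt2IE n p k σ ⇒ b ≤ rank KY_{p,k}(det_n)`), which cell tables use with `decide +kernel` on `lt2IE` (first use:
`Max/KYCannotSeparatePaddedPerThreeAtFour.lean`, the `n = 4` slice of N-F-1).

HONEST FRAMING: a counting identity for the cell's own bound `LT2`; an ingredient of METHOD-CEILING statements for ONE flattening family; nothing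
here bears on dc(per_m), VP vs VNP or P vs NP. Mathematics: theory-2 gen 27 (memo FINDINGS-LT2 §1 Thm 2); inclusion–exclusion is textbook.
-/

open Finset

namespace Summit.PneNP.GCT

open Literature.Computability.AlgebraicComplexity Literature.Barriers.ValiantsHypothesis

namespace DetKYLeadingTermsTwo

open DetKYLeadingTerms (vpos)

section Count

variable (n p : ℕ) (σ : Equiv.Perm (Fin (n * n))) (I' J' : Finset (Fin n))

/-- The achievable `(p+1)`-sets `T` for fixed label rows/columns `(I', J')`. [folklore] -/
def achT : Finset (Finset (Fin (n * n))) :=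
  (univ.powersetCard (p + 1)).filter fun T => (witnesses n σ T I' J').Nonempty

/-- `A_w`: the `(p+1)`-sets achievable with the witness `w`. [folklore] -/
def achBy (w : Fin n × Fin n) : Finset (Finset (Fin (n * n))) :=
  (univ.powersetCard (p + 1)).filter fun T => w ∈ witnesses n σ T I' J'

/-- `⋂_{w ∈ C} A_w` as a filter. [folklore] -/
def interT (C : Finset (Fin n × Fin n)) : Finset (Finset (Fin (n * n))) :=
  (univ.powersetCard (p + 1)).filter fun T => ∀ w ∈ C, w ∈ witnesses n σ T I' J'

/-- `allowed(C)`: positions that may lie in the complement of `T` simultaneously for every witness in `C`. [folklore] -/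
def allowed (C : Finset (Fin n × Fin n)) : Finset (Fin (n * n)) :=
  univ.filter fun q => ∀ w ∈ C, q ≠ vpos n w ∧ (σ (vpos n w) < σ q → q ∈ block n I' J' w.1 w.2)

/-- `a_C = |allowed(C)|`. [folklore] -/
def aCount (C : Finset (Fin n × Fin n)) : ℕ := (allowed n σ I' J' C).card

end Count

/-- The inclusion–exclusion evaluation `LT2^{IE}_σ(n,p,k)` (an integer; equals `lt2Count` when `p + 1 ≤ n²`). [folklore] -/
def lt2IE (n p k : ℕ) (σ : Equiv.Perm (Fin (n * n))) : ℤ :=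
  ∑ I' ∈ (univ : Finset (Fin n)).powersetCard (k + 1), ∑ J' ∈ (univ : Finset (Fin n)).powersetCard (k + 1),
    ∑ C ∈ (I' ×ˢ J').powerset.filter (·.Nonempty),
      (-1 : ℤ) ^ (C.card + 1) * ((aCount n σ I' J' C).choose (n * n - (p + 1)) : ℤ)

variable {n p k : ℕ} {σ : Equiv.Perm (Fin (n * n))} {I' J' : Finset (Fin n)}

/-- Fibrewise: `LT2 = Σ_{I', J'} |achT(I', J')|`. [folklore] -/
theorem lt2Count_eq_sum_card_achT (n p k : ℕ) (σ : Equiv.Perm (Fin (n * n))) :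
    lt2Count n p k σ = ∑ I' ∈ (univ : Finset (Fin n)).powersetCard (k + 1),
      ∑ J' ∈ (univ : Finset (Fin n)).powersetCard (k + 1), (achT n p σ I' J').card := by
  simp only [lt2Count, labels, achT, card_filter]
  rw [sum_product, sum_comm, sum_product]

/-- The achievable sets are the union of the `A_w` over the witnesses. [folklore] -/
theorem achT_eq_biUnion (n p : ℕ) (σ : Equiv.Perm (Fin (n * n))) (I' J' : Finset (Fin n)) :
    achT n p σ I' J' = (I' ×ˢ J').biUnion (achBy n p σ I' J') := by
  ext T
  simp only [achT, achBy, mem_filter, mem_biUnion, mem_product]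
  constructor
  · rintro ⟨hT, w, hw⟩
    exact ⟨w, ⟨(mem_witnesses.1 hw).1, (mem_witnesses.1 hw).2.1⟩, hT, hw⟩
  · rintro ⟨w, -, hT, hw⟩
    exact ⟨hT, w, hw⟩

/-- `inf'` of the `A_w` over a nonempty `C` is the filter `interT C`. [folklore] -/
theorem inf'_achBy_eq (C : Finset (Fin n × Fin n)) (hC : C.Nonempty) :
    C.inf' hC (achBy n p σ I' J') = interT n p σ I' J' C := by
  apply le_antisymm
  · intro T hT
    obtain ⟨w₀, hw₀⟩ := hC
    have hmem : ∀ w ∈ C, T ∈ achBy n p σ I' J' w := fun w hw => Finset.mem_of_subset (Finset.inf'_le _ hw) hT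
    simp only [achBy, interT, mem_filter] at hmem ⊢
    exact ⟨(hmem w₀ hw₀).1, fun w hw => (hmem w hw).2⟩
  · exact Finset.le_inf' _ _ fun w hw T hT => by
      simp only [achBy, interT, mem_filter] at hT ⊢
      exact ⟨hT.1, hT.2 w hw⟩

/-- Complementation: `|⋂_{w∈C} A_w| = C(a_C, n² − 1 − p)`. [folklore] -/
theorem card_interT (hp : p + 1 ≤ n * n) (C : Finset (Fin n × Fin n)) (hC : C ⊆ I' ×ˢ J') :
    (interT n p σ I' J' C).card = (aCount n σ I' J' C).choose (n * n - (p + 1)) := by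
  have key : interT n p σ I' J' C = ((allowed n σ I' J' C).powersetCard (n * n - (p + 1))).image compl := by
    ext T
    simp only [interT, mem_filter, mem_witnesses, mem_powersetCard, subset_univ, true_and, mem_image]
    constructor
    · rintro ⟨hT, hach⟩
      refine ⟨Tᶜ, ⟨?_, ?_⟩, compl_compl T⟩
      · intro q hq
        rw [mem_compl] at hq
        simp only [allowed, mem_filter, mem_univ, true_and]
        intro w hw
        have h := hach w hw
        exact ⟨fun hqw => hq (by rw [hqw]; exact h.2.2.1), fun hlt => h.2.2.2 q hlt hq⟩
      · rw [card_compl, Fintype.card_fin, hT]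
    · rintro ⟨U, ⟨hUsub, hUcard⟩, rfl⟩
      refine ⟨?_, fun w hw => ?_⟩
      · rw [card_compl, Fintype.card_fin, hUcard, Nat.sub_sub_self hp]
      · have hw' := mem_product.1 (hC hw)
        refine ⟨hw'.1, hw'.2, ?_, fun q hlt hq => ?_⟩
        · rw [mem_compl]
          intro hU
          exact ((mem_filter.1 (hUsub hU)).2 w hw).1 rfl
        · rw [mem_compl, not_not] at hq
          exact ((mem_filter.1 (hUsub hq)).2 w hw).2 hlt
  rw [key, card_image_of_injective _ compl_injective, card_powersetCard, aCount]

/-- Inclusion–exclusion for one `(I', J')`. [folklore] -/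
theorem card_achT_eq (hp : p + 1 ≤ n * n) (I' J' : Finset (Fin n)) :
    ((achT n p σ I' J').card : ℤ) = ∑ C ∈ (I' ×ˢ J').powerset.filter (·.Nonempty),
      (-1 : ℤ) ^ (C.card + 1) * ((aCount n σ I' J' C).choose (n * n - (p + 1)) : ℤ) := by
  rw [achT_eq_biUnion, inclusion_exclusion_card_biUnion, ← sum_coe_sort ((I' ×ˢ J').powerset.filter (·.Nonempty))]
  refine Finset.sum_congr rfl fun t _ => ?_
  have ht := mem_filter.1 t.2
  rw [inf'_achBy_eq, card_interT hp _ (mem_powerset.1 ht.1)]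

/-- **Theorem 2 of the memo**: `LT2_σ(n,p,k) = LT2^{IE}_σ(n,p,k)` for `p + 1 ≤ n²`. [folklore] -/
theorem lt2Count_eq_lt2IE (hp : p + 1 ≤ n * n) : (lt2Count n p k σ : ℤ) = lt2IE n p k σ := by
  rw [lt2Count_eq_sum_card_achT, lt2IE]
  push_cast
  exact Finset.sum_congr rfl fun I' _ => Finset.sum_congr rfl fun J' _ => card_achT_eq hp I' J'

/-- Hence any lower bound computed from the evaluation is a rank bound. [folklore] -/
theorem le_kyRank_detPoly_of_le_lt2IE (K : Type*) [Field K] (hp : p + 1 ≤ n * n) (b : ℕ)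
    (hb : (b : ℤ) ≤ lt2IE n p k σ) : b ≤ kyRank K p k (detPoly (Fin n) K) := by
  have h : b ≤ lt2Count n p k σ := by exact_mod_cast (lt2Count_eq_lt2IE (k := k) (σ := σ) hp ▸ hb)
  exact h.trans (lt2Count_le_kyRank_detPoly K n p k σ)

/-! ### Kernel sanity (det₃, `(p,k) = (4,1)`, row-major): the evaluation returns the brute-force count `726`. -/

example : lt2IE 3 4 1 1 = 726 := by decide +kernel

end DetKYLeadingTermsTwo

/-! ## The packaged statement of this module (PROVED) -/

/-- **Inclusion–exclusion evaluation of `LT2`** (theory-2 FINDINGS-LT2 Thm 2): for `p + 1 ≤ n²` and every order `σ`,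
`lt2Count n p k σ = Σ_{I′,J′} Σ_{∅≠C⊆I′×J′} (−1)^{|C|+1} C(a_C, n²−1−p)` (`DetKYLeadingTermsTwo.lt2IE`). A statement of the cell, PROVED below. [folklore] -/
def LT2InclusionExclusion : Prop :=
  ∀ (n p k : ℕ) (σ : Equiv.Perm (Fin (n * n))), p + 1 ≤ n * n →
    (DetKYLeadingTermsTwo.lt2Count n p k σ : ℤ) = DetKYLeadingTermsTwo.lt2IE n p k σ

/-- `LT2InclusionExclusion` holds. [folklore] -/
theorem lt2InclusionExclusion_holds : LT2InclusionExclusion :=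
  fun _ _ _ _ hp => DetKYLeadingTermsTwo.lt2Count_eq_lt2IE hp

/-- **The certificate interface** (what a cell table uses): an integer `b` below the kernel-evaluable `lt2IE n p k σ` is below
`rank KY_{p,k}(det_n)` (`p + 1 ≤ n²`). PROVED below. [folklore] -/
def LT2Certificate : Prop :=
  ∀ (n p k b : ℕ) (σ : Equiv.Perm (Fin (n * n))), p + 1 ≤ n * n →
    (b : ℤ) ≤ DetKYLeadingTermsTwo.lt2IE n p k σ → b ≤ kyRank ℂ p k (detPoly (Fin n) ℂ)

/-- `LT2Certificate` holds. [folklore] -/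
theorem lt2Certificate_holds : LT2Certificate :=
  fun _ _ _ b _ hp hb => DetKYLeadingTermsTwo.le_kyRank_detPoly_of_le_lt2IE ℂ hp b hb

end Summit.PneNP.GCT
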